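import Summits.Ventures.CertifiedManyBodySolver.Transport.LTIPrimalHubbardChainWindow
import HarnessLib

/-!
# Ventures/CertifiedManyBodySolver — Conjectures/WindowBandBottom.lean: STRUCTURE CONJ **C-M1D-2** (band-bottom blindness of
# translation-covariant window pseudo-moment relaxations of the Hubbard chain), TYPED

HONEST FRAMING: first certified bounds; not a superconductivity verdict; every number certified or labelled float.

STRUCTURE CONJ C-M1D-2 (m1-4 g7, prereg `HOME/sr-mbsolver-m1-4/structure/P-M1D-4.txt` sha16 253613d7551960c2, 2026-08-22T23:13:15Z; blind test
DS2 kit j176094 25/25 (`structure/ds2/DS2-SCORE.md`, kink table `37f1c243edcf9303`, refs `481b8b7baab337a6`); identified on DS1 kit j174334 / j174415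
14/14 (`structure/ds1/DS1-SCORE.md`, kink table `0d5ba6d6dbdd41b8`, refs `8ff1709a68561710`); proof sketch `HOME/sr-mbsolver-m1-4/STRUCTURE-TM1-doped.md`
v0.3 §E′ sha16 `b00aa688ec921b76` — NOT kernel-checked except step (1) below). Typed on the M1 lead's STANDING RULE (5) hand-over (HOME/INBOX
l.7755; words l.7793, l.7799) by the LIT lead lit-1 g15, 2026-08-23. THE STATEMENT (§E′): for the PLAIN translation-covariant pseudo-moment
relaxation of the Hubbard chain (`t = 1`) on a window of `w` sites — moments of words of degree ≤ 4 in the `4w` letters `c_{iσ}`, `c†_{iσ}`, PSD of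
the degree-≤2 Gram block ONLY, `ω(1) = 1`, identification of in-window translates, density rows `ω(n_{0σ}) = n/2`, equation-of-motion rows — the
optimal energy per site `e_P(n, U, w)` equals the band bottom `−2n` EXACTLY iff `n·w ≤ 1` (`U > 0`), resp. iff `n·w ≤ 2` (`U = 0`); above threshold
`e_P > −2n`; always `e_P ≥ −2n`. NOT COVERED: programs whose extra Gram blocks reach beyond the window (reach families; prediction P-M1D-19).

WHAT IS TYPED (the T-M1 owner's wording requests (i)–(iii)):
(i) THE INTERFACE ALONE, in two layers (monotonicity word l.7793 (c)): `WindowPseudoMomentCore m n` (window `{0, …, m+1} ⊂ ℤ`, `w = m + 2`): a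
    ℂ-linear functional `μ` on the window CAR algebra `FermionOp (chainWindow 0 (m+1))` (the tree's Jordan–Wigner matrix algebra — linearity and
    CAR rewriting automatic; words = products of the letters `cAt` / `cAtᴴ`) with `μ 1 = 1`, Hermitian symmetry, PSD of the Gram form on the span of
    the words of degree ≤ 2 (the ONLY positivity), translation identification on the degree-≤4 words of `{0, …, m}`, density rows; and
    `WindowPseudoMoment m n U` = core + the EOM rows `μ(H_W·O − O·H_W) = 0` for every degree-≤2 word `O` on the INTERIOR `{1, …, m}` (so that
    `[H_ℤ, O] = [H_W, O]`; the DS programs' `eom` row sets are sub-families). NOTHING here says such functionals bound `e₀` (that is the landed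
    duality lemmas' job). A functional on all of `𝔄_W` constrained only on low-degree words has the program's feasible set of moments.
(ii) THE LAW AS SEPARATE NAMED `Prop`s over exact rationals (`n * (m+2)` vs `1`, `2`): `C_M1D_2.lowerBound` (core; PROVED: `lowerBound_holds`),
    `rigidityPos` / `rigidityZero` (core — no EOM rows, stronger, and what §E′ proves; `.full` transports them to every EOM family),
    `witnessPos` / `witnessZero` (full interface — stronger than for any row sub-family; witnesses = vacuum ⊕ one `k = 0` particle per spin,
    quasi-free `(n/2)J_w`), `valuePos` / `valueZero` (`windowValue = sInf`, asserting attainment too, §E′ step (5)).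
(iii) every OPEN `Prop` is an `@[conjecture] def … : Prop` with the evidence ledger in its docstring — nothing asserted, no `sorry`, no axiom, no
    Literature fact. COMPANION = the '⇒' half PROVED ABSTRACTLY (m1-4 g8, p347041 `Conjectures/BandBottomBlindness.lean`, owner's division of
    labour HOME/INBOX l.7841): over a real inner-product GNS interface `WindowPseudoState V w n` the theorems `energy_ge`, `nw_le_one_of_energy_eq`,
    `nw_le_two_of_energy_eq_zeroU`, `bandBottom_only_if` (not restated here). BRIDGE STILL MISSING (support item, any prover): the GNS map
    `WindowPseudoMomentCore m n → WindowPseudoState V (m+2) n` (inner-product space = degree-≤2 words modulo the Gram null space), under which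
    `rigidityPos` / `rigidityZero` become corollaries of those theorems (`lowerBound` is already proved here directly); the conjecture's LIVE OPEN
    content is then `witnessPos` / `witnessZero` (the programs admit the §E′ witnesses). NEAREST PRIOR (m1-4's presearch): none for a
    relaxation-triviality threshold law; closest in spirit Verstichel et al. 2012 = arXiv:1110.5732. [cite: KullEtAl2024, §II.B, §VI.B]
    [cite: ArakiMoriya2003, §4.1]
-/

noncomputable section

open Matrix Complex
open scoped ComplexOrder BigOperators
open Literature.Probability.LatticeModels
open Literature.MathematicalPhysics.QuantumLattice
open Literature.MathematicalPhysics.QuantumLattice.JordanWigner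
open Summit.Ventures.CertifiedManyBodySolver.Transport

namespace Summit.Ventures.CertifiedManyBodySolver.Conjectures

/-! ## §A  Windows, letters, words -/

/-- The chain site with coordinate `z` (`ℤ¹ = Fin 1 → ℤ`). [folklore] -/
def chainSite (z : ℤ) : Site 1 := fun _ => z

/-- `chainSite z ∈ {a, …, b}` iff `a ≤ z ≤ b`. [folklore] -/
theorem chainSite_mem_chainWindow {a b z : ℤ} (h₁ : a ≤ z) (h₂ : z ≤ b) : chainSite z ∈ chainWindow a b :=
  mem_chainWindow.2 ⟨h₁, h₂⟩

/-- The interior `{1, …, m}` of the window `{0, …, m+1}`. [folklore] -/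
theorem chainWindow_interior_subset (m : ℕ) : chainWindow 1 (m : ℤ) ⊆ chainWindow 0 ((m : ℤ) + 1) := fun x hx => by
  rw [mem_chainWindow] at hx ⊢
  omega

/-- `{0, …, m} ⊆ {0, …, m+1}`. [folklore] -/
theorem chainWindow_init_subset (m : ℕ) : chainWindow 0 (m : ℤ) ⊆ chainWindow 0 ((m : ℤ) + 1) :=
  chainWindow_mono_right 0 (by omega)

/-- The LETTERS of a region: the `4|Λ|` operators `c_{xσ}`, `c†_{xσ}` (`x ∈ Λ`, `σ ∈ {↑, ↓}`) of the local CAR algebra `𝔄_Λ`.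
[cite: ArakiMoriya2003, §4.1 Def. 4.1 (2)] -/
def letters (Λ : Finset (Site 1)) : Set (FermionOp Λ) :=
  {A | ∃ (x : Site 1) (hx : x ∈ Λ) (σ : Fin 2), A = cAt x hx σ ∨ A = (cAt x hx σ)ᴴ}

/-- The ℂ-span of the WORDS of degree `≤ k`: products of at most `k` letters (the empty product = the identity word `1` included). This is
the moment-SDP "basis of degree ≤ k" as a subspace of `𝔄_Λ` (CAR rewriting is automatic in the matrix algebra). [cite: KullEtAl2024, §II.B] -/
def wordSpan (Λ : Finset (Site 1)) (k : ℕ) : Submodule ℂ (FermionOp Λ) :=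
  Submodule.span ℂ {A | ∃ l : List (FermionOp Λ), l.length ≤ k ∧ (∀ a ∈ l, a ∈ letters Λ) ∧ A = l.prod}

/-- A letter is a word of degree `≤ k` for `k ≥ 1`. [folklore] -/
theorem letter_mem_wordSpan {Λ : Finset (Site 1)} {k : ℕ} (hk : 1 ≤ k) {A : FermionOp Λ} (hA : A ∈ letters Λ) :
    A ∈ wordSpan Λ k :=
  Submodule.subset_span ⟨[A], by simpa using hk, by simpa using hA, by simp⟩

/-! ## §B  The window Hamiltonian and the site energy (`t = 1`) -/

section Hamiltonian

variable (m : ℕ)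

/-- Membership of the site `i ≤ m+1` in the window `{0, …, m+1}`. [folklore] -/
theorem chainSite_mem (i : ℕ) (hi : i ≤ m + 1) : chainSite (i : ℤ) ∈ chainWindow 0 ((m : ℤ) + 1) :=
  chainSite_mem_chainWindow (by omega) (by exact_mod_cast hi)

/-- The hopping word of the bond `(i, i+1)`, both spins: `Σ_σ (c†_{iσ} c_{i+1,σ} + c†_{i+1,σ} c_{iσ})` (`i ≤ m`). [cite: EsslerEtAl2005, §2.1 eq. (2.1)] -/
def bondHop (i : ℕ) (hi : i ≤ m) : FermionOp (chainWindow 0 ((m : ℤ) + 1)) :=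
  ∑ σ : Fin 2, ((cAt (chainSite i) (chainSite_mem m i (by omega)) σ)ᴴ * cAt (chainSite (i + 1)) (chainSite_mem m (i + 1) (by omega)) σ +
    (cAt (chainSite (i + 1)) (chainSite_mem m (i + 1) (by omega)) σ)ᴴ * cAt (chainSite i) (chainSite_mem m i (by omega)) σ)

/-- The on-site word `n_{i↑} n_{i↓}` (`i ≤ m+1`). [cite: EsslerEtAl2005, §2.1 eq. (2.1)] -/
def siteDouble (i : ℕ) (hi : i ≤ m + 1) : FermionOp (chainWindow 0 ((m : ℤ) + 1)) :=
  nAt (chainSite i) (chainSite_mem m i hi) 0 * nAt (chainSite i) (chainSite_mem m i hi) 1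

/-- **The window Hamiltonian** `H_W = −Σ_{i=0}^{m} Σ_σ (c†_{iσ}c_{i+1,σ} + h.c.) + U Σ_{i=0}^{m+1} n_{i↑}n_{i↓}` on `{0, …, m+1}` (`t = 1`): the part
of the chain Hamiltonian whose commutator with an INTERIOR word is the full commutator. [cite: EsslerEtAl2005, §2.1 eq. (2.1)] -/
def windowHamiltonian (U : ℝ) : FermionOp (chainWindow 0 ((m : ℤ) + 1)) :=
  -(∑ i : Fin (m + 1), bondHop m i (by omega)) + (U : ℂ) • ∑ i : Fin (m + 2), siteDouble m i (by omega)

/-- **The energy-per-site word** `h₀ = −Σ_σ (c†_{0σ}c_{1σ} + c†_{1σ}c_{0σ}) + U n_{0↑}n_{0↓}` (one bond + one site; under translation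
identification its value is the relaxation's objective = energy per site, `t = 1`). [cite: KullEtAl2024, §II.B] -/
def siteEnergy (U : ℝ) : FermionOp (chainWindow 0 ((m : ℤ) + 1)) :=
  -bondHop m 0 (by omega) + (U : ℂ) • siteDouble m 0 (by omega)

end Hamiltonian

/-! ## §C  THE INTERFACE: translation-covariant window pseudo-moments (the feasible set of the plain window program) -/

/-- **Window pseudo-moment functional** — the feasible point of the PLAIN translation-covariant moment relaxation of the Hubbard chain
(`t = 1`, coupling `U`, total density `n`, i.e. `n/2` per spin) on the window `{0, …, m+1}` of `w = m + 2` sites: a ℂ-linear functional `μ`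
on the window CAR algebra `𝔄_W = FermionOp (chainWindow 0 (m+1))` such that
* `map_one`: `μ(1) = 1` (normalisation word);
* `map_star`: `μ(Aᴴ) = conj μ(A)` (Hermitian moment matrix);
* `gram_nonneg`: `μ(AᴴA) ≥ 0` for every `A` in the span of the words of degree ≤ 2 — positivity of the degree-≤2 Gram block, and NO other
  positivity (in `ComplexOrder`: real part `≥ 0`, imaginary part `0`);
* `transl`: `μ(Γ(τ₊₁) a) = μ(Γ(incl) a)` for every `a` in the span of the words of degree ≤ 4 on the sites `{0, …, m}` — identification of
  in-window translates (`Γ` = the tree's isotony/covariance maps `fermionEmbed`, `τ₊₁ = PolySite.affEmb 1 (unitVec 0)`);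
* `density`: `μ(n_{0σ}) = n/2` for both spins;
* `eom`: `μ(H_W·O − O·H_W) = 0` for every `O` in the span of the words of degree ≤ 2 on the interior sites `{1, …, m}` (equation-of-motion
  rows; for such `O`, `[H_ℤ, O] = [H_W, O]`).
This is an INTERFACE only: it posits the program's feasible set and says nothing about ground states or lower bounds (those are the landed
duality lemmas). It is split in two layers on the M1 lead's monotonicity word (HOME/INBOX l.7793 (c)): the CORE `WindowPseudoMomentCore m n`
(everything except the equation-of-motion rows — no `U`-dependence) over which the LOWER BOUND and the RIGIDITY halves are stated (they are
then STRONGER than for any EOM family, and §E′ proves them without EOM rows), and the full `WindowPseudoMoment m n U` (core + ALL interior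
EOM rows) over which the WITNESS halves and the value are stated (a witness for the maximal interior family is one for every sub-family the
DS1/DS2 programs ran: 14 rows at `w = 4`, 44 with `e6`, 48 with `R12`). [cite: KullEtAl2024, §II.B eqs. (locTIn), §VI.B]
[cite: ArakiMoriya2003, §4.1 Def. 4.1, Def. 4.3] -/
structure WindowPseudoMomentCore (m : ℕ) (n : ℚ) where
  /-- The pseudo-expectation functional on the window CAR algebra. -/
  μ : FermionOp (chainWindow 0 ((m : ℤ) + 1)) →ₗ[ℂ] ℂ
  /-- Normalisation `μ(1) = 1`. -/
  map_one : μ 1 = 1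
  /-- Hermitian symmetry `μ(Aᴴ) = conj μ(A)`. -/
  map_star : ∀ A, μ Aᴴ = starRingEnd ℂ (μ A)
  /-- PSD of the degree-≤2 Gram form: `μ(AᴴA) ≥ 0` for `A ∈ span(words of degree ≤ 2)`. -/
  gram_nonneg : ∀ A ∈ wordSpan (chainWindow 0 ((m : ℤ) + 1)) 2, 0 ≤ μ (Aᴴ * A)
  /-- Translation identification on words of degree ≤ 4 living on `{0, …, m}`. -/
  transl : ∀ a ∈ wordSpan (chainWindow 0 (m : ℤ)) 4,
    μ (fermionEmbed ((PolySite.affEmb 1 (unitVec 0) (chainWindow 0 (m : ℤ))).trans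
        (PolySite.incl (affShiftSet_chainWindow_subset 0 (m : ℤ)))) a) =
      μ (fermionEmbed (PolySite.incl (chainWindow_init_subset m)) a)
  /-- Density rows `μ(n_{0σ}) = n/2`. -/
  density : ∀ σ : Fin 2, μ (nAt (chainSite 0) (chainSite_mem m 0 (by omega)) σ) = (((n / 2 : ℚ) : ℝ) : ℂ)

/-- **Window pseudo-moment functional, full interface** = the core + the EQUATION-OF-MOTION rows `μ(H_W·O − O·H_W) = 0` for every `O` in the
span of the words of degree ≤ 2 on the interior sites `{1, …, m}` (the maximal family whose chain commutator stays inside the window; the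
DS1/DS2 programs' `eom`/`eomx` row sets are sub-families of it). [cite: KullEtAl2024, §II.B, §VI.B] -/
structure WindowPseudoMoment (m : ℕ) (n : ℚ) (U : ℝ) extends WindowPseudoMomentCore m n where
  /-- Equation-of-motion rows `μ([H_W, O]) = 0` for words `O` of degree ≤ 2 on the interior `{1, …, m}`. -/
  eom : ∀ O ∈ wordSpan (chainWindow 1 (m : ℤ)) 2,
    μ (windowHamiltonian m U * fermionEmbed (PolySite.incl (chainWindow_interior_subset m)) O -
        fermionEmbed (PolySite.incl (chainWindow_interior_subset m)) O * windowHamiltonian m U) = 0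

variable {m : ℕ} {n : ℚ} {U : ℝ}

/-- The objective of the window program read on a core feasible point at coupling `U`: `Re μ(h₀)`, the relaxation's energy per site. -/
def WindowPseudoMomentCore.energy (P : WindowPseudoMomentCore m n) (U : ℝ) : ℝ := (P.μ (siteEnergy m U)).re

/-- The objective of the window program at a feasible point: `Re μ(h₀)`. -/
def WindowPseudoMoment.energy (P : WindowPseudoMoment m n U) : ℝ := P.toWindowPseudoMomentCore.energy U


/-- **The optimal value `e_P(n, U, w)`** of the plain window program (`w = m + 2`): the infimum of the energies of its feasible points
(`sInf`; `= 0` by convention on an empty feasible set). -/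
def windowValue (m : ℕ) (n : ℚ) (U : ℝ) : ℝ := sInf (Set.range fun P : WindowPseudoMoment m n U => P.energy)

/-! ## §D  STRUCTURE CONJ C-M1D-2, as separate named `Prop`s (nothing asserted) -/

namespace C_M1D_2

/-- **C-M1D-2, lower bound (§E′ step (1))**, over the CORE interface (no EOM rows): every core-feasible window pseudo-moment has energy `≥ −2n` (`U ≥ 0`; the Gram vector
`c_{1σ} − c_{0σ}` gives `Re μ(c†_{0σ}c_{1σ} + c†_{1σ}c_{0σ}) ≤ n`, and `μ(n_{0↑}n_{0↓}) = μ((c_{0↓}c_{0↑})ᴴ(c_{0↓}c_{0↑})) ≥ 0`). PROVED below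
(`lowerBound_holds`, kernel-checked); kept as a named `Prop` so that the five open halves and this one have the same shape. STRUCTURE CONJ
C-M1D-2 (m1-4 g7, prereg P-M1D-4.txt sha256 253613d7… 2026-08-22T23:13:15Z; blind test DS2 j176094 25/25; proof sketch
STRUCTURE-TM1-doped.md v0.3 §E′ b00aa688ec921b76 — the OTHER halves not kernel-checked). -/
def lowerBound : Prop :=
  ∀ (m : ℕ) (n : ℚ) (U : ℝ), 0 ≤ U → ∀ P : WindowPseudoMomentCore m n, -2 * (n : ℝ) ≤ P.energy U

/-- **C-M1D-2, witness half, `U > 0` (§E′ step (3) ⇐)**, over the FULL interface (ALL interior EOM rows — stronger than for any sub-family): for `n·w ≤ 1` (`w = m + 2`, exact rationals) the band bottom `−2n` is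
ATTAINED by a feasible point (vacuum with weight `1 − nw` ⊕ weight `nw/2` per spin on ONE particle in the `k = 0` window orbital).
STRUCTURE CONJ C-M1D-2 (m1-4 g7, prereg P-M1D-4.txt sha256 253613d7… 2026-08-22T23:13:15Z; blind test DS2 j176094 25/25; proof sketch
STRUCTURE-TM1-doped.md v0.3 §E′ b00aa688ec921b76 — not kernel-checked). -/
@[conjecture] def witnessPos : Prop :=
  ∀ (m : ℕ) (n : ℚ) (U : ℝ), 0 < U → 0 < n → n * (m + 2) ≤ 1 →
    ∃ P : WindowPseudoMoment m n U, P.energy = -2 * (n : ℝ)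

/-- **C-M1D-2, rigidity half, `U > 0` (§E′ steps (2)–(3) ⇒)**, over the CORE interface (no EOM rows — stronger; §E′ uses none): for `n·w > 1` NO core-feasible point attains `−2n` (zero-norm propagation
of `c_{1σ} − c_{0σ}` kills all same-spin two-body moments and makes the window particle-number variance `nw − (nw)² ≥ 0` binding).
STRUCTURE CONJ C-M1D-2 (m1-4 g7, prereg P-M1D-4.txt sha256 253613d7… 2026-08-22T23:13:15Z; blind test DS2 j176094 25/25; proof sketch
STRUCTURE-TM1-doped.md v0.3 §E′ b00aa688ec921b76 — not kernel-checked). -/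
@[conjecture] def rigidityPos : Prop :=
  ∀ (m : ℕ) (n : ℚ) (U : ℝ), 0 < U → 1 < n * (m + 2) →
    ∀ P : WindowPseudoMomentCore m n, P.energy U ≠ -2 * (n : ℝ)

/-- **C-M1D-2, witness half, `U = 0` (§E′ step (4) ⇐, Pauli)**, over the FULL interface: for `n·w ≤ 2` the quasi-free functional with one-body matrix `(n/2)J_w`
is feasible and attains `−2n`. STRUCTURE CONJ C-M1D-2 (m1-4 g7, prereg P-M1D-4.txt sha256 253613d7… 2026-08-22T23:13:15Z; blind test
DS2 j176094 25/25; proof sketch STRUCTURE-TM1-doped.md v0.3 §E′ b00aa688ec921b76 — not kernel-checked). -/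
@[conjecture] def witnessZero : Prop :=
  ∀ (m : ℕ) (n : ℚ), 0 < n → n * (m + 2) ≤ 2 →
    ∃ P : WindowPseudoMoment m n 0, P.energy = -2 * (n : ℝ)

/-- **C-M1D-2, rigidity half, `U = 0` (§E′ steps (2), (4) ⇒)**, over the CORE interface (no EOM rows): for `n·w > 2` NO core-feasible point attains `−2n` (`ρ_σ ≡ n/2` on the whole
one-body block and `1 − (n/2)J_w ⪰ 0` iff `nw ≤ 2`). STRUCTURE CONJ C-M1D-2 (m1-4 g7, prereg P-M1D-4.txt sha256 253613d7…
2026-08-22T23:13:15Z; blind test DS2 j176094 25/25; proof sketch STRUCTURE-TM1-doped.md v0.3 §E′ b00aa688ec921b76 — not kernel-checked). -/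
@[conjecture] def rigidityZero : Prop :=
  ∀ (m : ℕ) (n : ℚ), 2 < n * (m + 2) →
    ∀ P : WindowPseudoMomentCore m n, P.energy 0 ≠ -2 * (n : ℝ)

/-- **C-M1D-2, value level, `U > 0`**: for `0 < n ≤ 1`, `U > 0`: `e_P(n, U, w) = −2n ↔ n·w ≤ 1` (this form also asserts ATTAINMENT of the
infimum, §E′ step (5), compact feasible set). STRUCTURE CONJ C-M1D-2 (m1-4 g7, prereg P-M1D-4.txt sha256 253613d7… 2026-08-22T23:13:15Z;
blind test DS2 j176094 25/25; proof sketch STRUCTURE-TM1-doped.md v0.3 §E′ b00aa688ec921b76 — not kernel-checked). -/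
@[conjecture] def valuePos : Prop :=
  ∀ (m : ℕ) (n : ℚ) (U : ℝ), 0 < U → 0 < n → n ≤ 1 →
    (windowValue m n U = -2 * (n : ℝ) ↔ n * (m + 2) ≤ 1)

/-- **C-M1D-2, value level, `U = 0`**: for `0 < n ≤ 1`: `e_P(n, 0, w) = −2n ↔ n·w ≤ 2`. STRUCTURE CONJ C-M1D-2 (m1-4 g7, prereg
P-M1D-4.txt sha256 253613d7… 2026-08-22T23:13:15Z; blind test DS2 j176094 25/25; proof sketch STRUCTURE-TM1-doped.md v0.3 §E′
b00aa688ec921b76 — not kernel-checked). -/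
@[conjecture] def valueZero : Prop :=
  ∀ (m : ℕ) (n : ℚ), 0 < n → n ≤ 1 → (windowValue m n 0 = -2 * (n : ℝ) ↔ n * (m + 2) ≤ 2)

/-- Bookkeeping (no mathematics): under the lower bound and the `U > 0` witness half, the value is `≤ −2n` wherever `n·w ≤ 1` — the easy
direction of `valuePos` modulo boundedness below, which `lowerBound` supplies. [folklore] -/
theorem windowValue_le_of_witness (hlo : lowerBound) (hw : witnessPos) {m : ℕ} {n : ℚ} {U : ℝ} (hU : 0 < U) (hn : 0 < n)
    (hnw : n * (m + 2) ≤ 1) : windowValue m n U ≤ -2 * (n : ℝ) := by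
  obtain ⟨P, hP⟩ := hw m n U hU hn hnw
  have hbdd : BddBelow (Set.range fun Q : WindowPseudoMoment m n U => Q.energy) :=
    ⟨-2 * (n : ℝ), by rintro _ ⟨Q, rfl⟩; exact hlo m n U hU.le Q.toWindowPseudoMomentCore⟩
  exact (csInf_le hbdd ⟨P, rfl⟩).trans_eq hP

/-- MONOTONICITY (no mathematics): rigidity over the core interface gives rigidity over the full interface (every EOM family), `U > 0`. [folklore] -/
theorem rigidityPos.full (h : rigidityPos) {m : ℕ} {n : ℚ} {U : ℝ} (hU : 0 < U) (hnw : 1 < n * (m + 2))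
    (P : WindowPseudoMoment m n U) : P.energy ≠ -2 * (n : ℝ) :=
  h m n U hU hnw P.toWindowPseudoMomentCore

/-- MONOTONICITY (no mathematics): rigidity over the core interface gives rigidity over the full interface, `U = 0`. [folklore] -/
theorem rigidityZero.full (h : rigidityZero) {m : ℕ} {n : ℚ} (hnw : 2 < n * (m + 2)) (P : WindowPseudoMoment m n 0) :
    P.energy ≠ -2 * (n : ℝ) :=
  h m n hnw P.toWindowPseudoMomentCore

end C_M1D_2

/-! ## §E  The elementary half HOLDS: `C_M1D_2.lowerBound` (§E′ step (1)), kernel-checked -/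

section LowerBound

/-- The unit translate of the chain site `z` is the chain site `z + 1`. [folklore] -/
theorem affSite_one_unitVec_chainSite (z : ℤ) : affSite 1 (unitVec 0) (chainSite z) = chainSite (z + 1) := by
  funext i
  have hi : i = 0 := Subsingleton.elim i 0
  subst hi
  simp [unitVec, chainSite]

/-- The translation-then-inclusion embedding `{0,…,m} → {1,…,m+1} ⊆ {0,…,m+1}` sends the ordered site `0` to the ordered site `1`.
[folklore] -/
theorem shiftIncl_pt_zero (m : ℕ) (h0 : chainSite 0 ∈ chainWindow 0 (m : ℤ)) (h1 : chainSite 1 ∈ chainWindow 0 ((m : ℤ) + 1)) :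
    ((PolySite.affEmb 1 (unitVec 0) (chainWindow 0 (m : ℤ))).trans
        (PolySite.incl (affShiftSet_chainWindow_subset 0 (m : ℤ)))) (PolySite.pt (chainSite 0) h0) =
      PolySite.pt (chainSite 1) h1 := by
  apply Subtype.ext
  change toLex (affSite 1 (unitVec 0) (chainSite 0)) = toLex (chainSite 1)
  rw [affSite_one_unitVec_chainSite, zero_add]

/-- `Γ(τ₊₁)` moves `n_{0σ}` to `n_{1σ}`. [cite: ArakiMoriya2003, §4.1 Def. 4.3] -/
theorem fermionEmbed_shiftIncl_nAt_zero (m : ℕ) (h0 : chainSite 0 ∈ chainWindow 0 (m : ℤ))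
    (h1 : chainSite 1 ∈ chainWindow 0 ((m : ℤ) + 1)) (σ : Fin 2) :
    fermionEmbed ((PolySite.affEmb 1 (unitVec 0) (chainWindow 0 (m : ℤ))).trans
        (PolySite.incl (affShiftSet_chainWindow_subset 0 (m : ℤ)))) (nAt (chainSite 0) h0 σ) =
      nAt (chainSite 1) h1 σ := by
  simp only [nAt, numberOp, map_mul, fermionEmbed_creation, fermionEmbed_annihilation, shiftIncl_pt_zero m h0 h1]

/-- `Γ(incl)` fixes `n_{xσ}` (isotony on generators). [cite: ArakiMoriya2003, §4.1 Def. 4.1 (2)] -/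
theorem fermionEmbed_incl_nAt' {Λ Λ' : Finset (Site 1)} (h : Λ ⊆ Λ') (x : Site 1) (hx : x ∈ Λ) (σ : Fin 2) :
    fermionEmbed (PolySite.incl h) (nAt x hx σ) = nAt x (h hx) σ := by
  simp only [nAt, numberOp, map_mul, fermionEmbed_creation, fermionEmbed_annihilation, PolySite.incl_pt]

/-- `c†_{xσ} c_{xσ} = n_{xσ}` (definitional). [folklore] -/
theorem cAt_conjTranspose_mul_cAt {Λ : Finset (Site 1)} (x : Site 1) (hx : x ∈ Λ) (σ : Fin 2) :
    (cAt x hx σ)ᴴ * cAt x hx σ = nAt x hx σ := rfl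

/-- `n_{x↑} n_{x↓} = (c_{x↓} c_{x↑})ᴴ (c_{x↓} c_{x↑})` (CAR). [cite: EsslerEtAl2005, §2.1 eqs. (2.2)] -/
theorem nAt_up_mul_nAt_down_eq {Λ : Finset (Site 1)} (x : Site 1) (hx : x ∈ Λ) :
    nAt x hx 0 * nAt x hx 1 = (cAt x hx 1 * cAt x hx 0)ᴴ * (cAt x hx 1 * cAt x hx 0) := by
  simp only [nAt, numberOp, cAt, Matrix.conjTranspose_mul, annihilation_conjTranspose]
  set a0 := annihilation (orb (PolySite.pt x hx) (0 : Fin 2))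
  set a1 := annihilation (orb (PolySite.pt x hx) (1 : Fin 2))
  set k0 := creation (orb (PolySite.pt x hx) (0 : Fin 2))
  set k1 := creation (orb (PolySite.pt x hx) (1 : Fin 2))
  have hne : orb (PolySite.pt x hx) (0 : Fin 2) ≠ orb (PolySite.pt x hx) 1 := by rw [Ne, orb_eq_orb_iff]; simp
  have h1 : a0 * k1 = -(k1 * a0) := by rw [annihilation_mul_creation, if_neg hne, zero_sub]
  have h2 : a1 * a0 = -(a0 * a1) := eq_neg_of_add_eq_zero_left (annihilation_anticommute_holds _ _)
  rw [show k0 * a0 * (k1 * a1) = k0 * (a0 * k1) * a1 by noncomm_ring, h1, h2]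
  noncomm_ring

/-- A difference of two letters is in the degree-≤2 word span. [folklore] -/
theorem cAt_sub_cAt_mem_wordSpan {Λ : Finset (Site 1)} (x y : Site 1) (hx : x ∈ Λ) (hy : y ∈ Λ) (σ : Fin 2) :
    cAt x hx σ - cAt y hy σ ∈ wordSpan Λ 2 :=
  Submodule.sub_mem _ (letter_mem_wordSpan (by norm_num) ⟨x, hx, σ, Or.inl rfl⟩)
    (letter_mem_wordSpan (by norm_num) ⟨y, hy, σ, Or.inl rfl⟩)

/-- A product of two annihilators is in the degree-≤2 word span. [folklore] -/
theorem cAt_mul_cAt_mem_wordSpan {Λ : Finset (Site 1)} (x y : Site 1) (hx : x ∈ Λ) (hy : y ∈ Λ) (σ τ : Fin 2) :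
    cAt x hx σ * cAt y hy τ ∈ wordSpan Λ 2 :=
  Submodule.subset_span ⟨[cAt x hx σ, cAt y hy τ], by simp, by
    intro a ha
    simp only [List.mem_cons, List.mem_nil_iff, or_false] at ha
    rcases ha with rfl | rfl
    · exact ⟨x, hx, σ, Or.inl rfl⟩
    · exact ⟨y, hy, τ, Or.inl rfl⟩, by simp⟩

/-- Real part of a `ComplexOrder`-nonnegative number is nonnegative. [folklore] -/
theorem re_nonneg_of_nonneg {z : ℂ} (h : 0 ≤ z) : 0 ≤ z.re := by simpa using (Complex.le_def.1 h).1

/-- **Hopping bound per spin**: `Re μ(c†_{0σ}c_{1σ} + c†_{1σ}c_{0σ}) ≤ n` for every feasible window pseudo-moment (Gram vector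
`c_{1σ} − c_{0σ}`, translation identification `μ(n_{1σ}) = μ(n_{0σ})`, density row). [folklore] -/
theorem WindowPseudoMomentCore.re_hop_le (P : WindowPseudoMomentCore m n) (σ : Fin 2) :
    (P.μ ((cAt (chainSite 0) (chainSite_mem m 0 (by omega)) σ)ᴴ * cAt (chainSite 1) (chainSite_mem m 1 (by omega)) σ +
        (cAt (chainSite 1) (chainSite_mem m 1 (by omega)) σ)ᴴ * cAt (chainSite 0) (chainSite_mem m 0 (by omega)) σ)).re ≤
      (n : ℝ) := by
  set c0 := cAt (chainSite 0) (chainSite_mem m 0 (by omega)) σ with hc0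
  set c1 := cAt (chainSite 1) (chainSite_mem m 1 (by omega)) σ with hc1
  -- Gram positivity on `c1 - c0`
  have hgram := P.gram_nonneg (c1 - c0) (cAt_sub_cAt_mem_wordSpan _ _ _ _ σ)
  have hexp : (c1 - c0)ᴴ * (c1 - c0) = c1ᴴ * c1 + c0ᴴ * c0 - (c0ᴴ * c1 + c1ᴴ * c0) := by
    rw [Matrix.conjTranspose_sub]
    noncomm_ring
  rw [hexp, map_sub, map_add] at hgram
  have hre := re_nonneg_of_nonneg hgram
  rw [Complex.sub_re, Complex.add_re] at hre
  -- the two number-operator moments are `n/2`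
  have hn0 : (P.μ (c0ᴴ * c0)).re = (n : ℝ) / 2 := by
    rw [hc0, cAt_conjTranspose_mul_cAt, P.density σ, Complex.ofReal_re]
    push_cast
    ring
  have h0m : chainSite 0 ∈ chainWindow 0 (m : ℤ) := chainSite_mem_chainWindow le_rfl (by exact_mod_cast Nat.zero_le m)
  have hn1 : (P.μ (c1ᴴ * c1)).re = (n : ℝ) / 2 := by
    have ht := P.transl (nAt (chainSite 0) h0m σ) (Submodule.subset_span ⟨[(cAt (chainSite 0) h0m σ)ᴴ, cAt (chainSite 0) h0m σ],
      by simp, by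
        intro a ha
        simp only [List.mem_cons, List.mem_nil_iff, or_false] at ha
        rcases ha with rfl | rfl
        · exact ⟨_, h0m, σ, Or.inr rfl⟩
        · exact ⟨_, h0m, σ, Or.inl rfl⟩, by simp [cAt_conjTranspose_mul_cAt]⟩)
    rw [fermionEmbed_shiftIncl_nAt_zero m h0m (chainSite_mem m 1 (by omega)), fermionEmbed_incl_nAt'] at ht
    rw [hc1, cAt_conjTranspose_mul_cAt, ht, P.density σ, Complex.ofReal_re]
    push_cast
    ring
  linarith

/-- **`C_M1D_2.lowerBound` HOLDS** (§E′ step (1), now kernel-checked): every feasible window pseudo-moment has energy `≥ −2n` when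
`U ≥ 0` — the hopping part is `≥ −2n` by `re_hop_le` (both spins) and `U·μ(n_{0↑}n_{0↓}) = U·μ(AᴴA) ≥ 0` with `A = c_{0↓}c_{0↑}` a word
of degree 2. [cite: KullEtAl2024, §II.B] -/
theorem C_M1D_2.lowerBound_holds : C_M1D_2.lowerBound := by
  intro m n U hU P
  have h0 := chainSite_mem m 0 (by omega)
  -- the interaction moment is nonnegative
  have hint : 0 ≤ (P.μ (siteDouble m 0 (by omega))).re := by
    have hg := P.gram_nonneg (cAt (chainSite 0) h0 1 * cAt (chainSite 0) h0 0) (cAt_mul_cAt_mem_wordSpan _ _ _ _ 1 0)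
    rw [← nAt_up_mul_nAt_down_eq] at hg
    exact re_nonneg_of_nonneg hg
  -- the hopping moment is at most `2n`
  have hhop : (P.μ (bondHop m 0 (by omega))).re ≤ 2 * (n : ℝ) := by
    have e0 : ∀ (h : chainSite ((0 : ℕ) : ℤ) ∈ chainWindow 0 ((m : ℤ) + 1)) (σ : Fin 2),
        cAt (chainSite ((0 : ℕ) : ℤ)) h σ = cAt (chainSite 0) (chainSite_mem m 0 (by omega)) σ :=
      fun h σ => cAt_congr h _ (by simp) σ
    have e1 : ∀ (h : chainSite (((0 : ℕ) : ℤ) + 1) ∈ chainWindow 0 ((m : ℤ) + 1)) (σ : Fin 2),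
        cAt (chainSite (((0 : ℕ) : ℤ) + 1)) h σ = cAt (chainSite 1) (chainSite_mem m 1 (by omega)) σ :=
      fun h σ => cAt_congr h _ (by simp) σ
    rw [bondHop, map_sum, Complex.re_sum, Fin.sum_univ_two]
    simp only [e0, e1]
    have hA := P.re_hop_le 0
    have hB := P.re_hop_le 1
    linarith
  -- assemble
  rw [WindowPseudoMomentCore.energy, siteEnergy, map_add, map_neg, map_smul, Complex.add_re, Complex.neg_re, smul_eq_mul,
    Complex.re_ofReal_mul]
  nlinarith [mul_nonneg hU hint]

/-- The lower bound on the full interface (every feasible point of the plain window program has energy `≥ −2n`, `U ≥ 0`). [folklore] -/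
theorem WindowPseudoMoment.neg_two_mul_le_energy (P : WindowPseudoMoment m n U) (hU : 0 ≤ U) : -2 * (n : ℝ) ≤ P.energy :=
  C_M1D_2.lowerBound_holds m n U hU P.toWindowPseudoMomentCore

end LowerBound

end Summit.Ventures.CertifiedManyBodySolver.Conjectures

end
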